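import Summits.QuantumFields.YangMills.Theorems.BalabanUVNodesN11Sect3SupplyChainNode
import Summits.QuantumFields.YangMills.Theorems.BalabanUVNodesN11FirstStepSupply
import Summits.QuantumFields.YangMills.Theorems.BalabanUVNodesN11OperandRowsOfTermRows
import Summits.QuantumFields.YangMills.Theorems.BalabanUVNodesN11BackgroundCoPMeasurable

/-!
# DAG node N11 — THE ZERO SUPPLIER: the witness chain CLOSES BY ITSELF in a run whose expansion children carry no 𝐓-slot — `SupplierObligations` is CONSISTENT (inhabited by
# zero terms there), def-T's operand rows hold OUTRIGHT along the zero chain, and THEOREM 1 OF [III] follows from the witness-free residual rows alone ∕ at a Gaussian certificate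
# from NOTHING but the data's key — the term-free corner of N11 (dag-n11-e g13's diagonal) extended from the all-large history to EVERY history of such a run

Cell `pub-ymgap`, YM-PLAN Track A (HUMAN RULING D-0062 ∕ D-0149), seat `pub-ymgap-dag-n11-e` (g16; R134 fan-out row N11∕s3), route `BalabanUVNodes` rev 25 (v1.7 `CoPH` key), item
K1⁷ `StabilityBAtRecordR13SepCoPH` = stmt-QuantumFields-20542 (helper, DEFINITION lane: one `def` + theorems, count-neutral).  [III] = [Balaban1988Convergent], [IV] =
[Balaban1989LargeFieldI].  Over this seat's `…Sect3SupplyChainObligationsDefs` ∕ `…Sect3SupplyChainNode` (p595576 ∕ p596032), dag-n08-w2's `sect2Operand_congr_of_agree_pos`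
(p586913: (2.23) at index `k` reads the term values at the levels `1 … k` only), dag-n11-d's `…OperandRowsOfTermRows` (operand measurability ∕ bound from term rows) and
`…BackgroundCoPMeasurable.measurable_UbgOfRecord₁₃CoP` (def-R's background map is measurable).

WHY THIS FILE (A2 ∕ A6 of the chain road, asked first-hand).  `SupplierObligations θ p σ` is [III] §3's content and is inhabited for NO `σ` in the tree; a referee must be able
to see that it is not inhabitable VACUOUSLY-BY-CONTRADICTION and that the chain machinery closes where §3 has nothing to construct.  Both are kernel facts:
§1 `zeroSupplier θ p` — no new terms at any level, the constant carried along — and ★ `chainWitness_zeroSupplier_agree_pos`: along ITS chain every term value at the levels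
   `1 ≤ j ≤ k` IS ZERO (induction over the splice; the opaque level-0 terms of def-T's base witness are never read — (2.25)∕(2.30)∕(2.40) sum over `j ≥ 1`).
§2 ★★ `operandRowsAlongChain_zeroSupplier` — def-T's OPERAND ROWS HOLD OUTRIGHT along the zero chain (the operand is `exp[−A(1∕g_k², U_k(𝐖)) − E]`: dag-n08-w2's congruence +
   dag-n11-d's term-row lemmas at zero terms + measurability of def-R's background), UNCONDITIONALLY; `supplierObligations_zeroSupplier_of_forall_absent` — in a run whose
   expansion children are all 𝐓-ABSENT (`slotsT (k+1) s′ = 0` whenever `Ω_{k+1}(s′) ≠ ∅`, every `k < K`) the zero supplier MEETS `SupplierObligations` (`0 ≤ E₀` only):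
   the obligations are consistent.
§3 THEOREM 1 IN SUCH A RUN: ★★ `sLaw₁₃CoPH_all_of_forall_absent_of_residualRows` (generic `θ`, live-selector line: from the witness-free `ResidualRows θ p` ALONE — no operand
   row, no supply) · ★★ `sLaw₁₃CoPH_all_of_forall_absent_of_gaussCert` (any `θ` of the Gaussian-certificate class: from NOTHING of the no-expansion lane) · ★★★
   `sLaw₁₃CoPH_all_gaussCertH_theta13LiveOfRecord_of_forall_absent` (at any Gaussian-class H-extension of the witness of record: from `hrec` — the datum's key — and the
   absence hypothesis, NOTHING ELSE).  dag-n11-e g13's `…DiagonalInductionNoBindersCoPH` proved Theorem 1 along the ONE all-large history with no hypothesis; this file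
   proves it at EVERY history of a run whose new small-field regions are never charged by the 𝐓-image.
HONEST FRAMING.  The absence hypothesis describes the DEGENERATE data world in which [III] §3 has nothing to construct (for the record's data the 𝐓-slots at expansion
children do NOT vanish — that is where the supply is owed); the value of the file is the certificate that the chain road is sound and closes by itself there.  Count-neutral;
nothing of Bałaban asserted; N11 NOT discharged; K1⁷ NOT closed; counts unmoved (typed 28∕28 · discharged 5∕27).  One finite `𝕋⁴_{L^K}` programme at fixed `ε = L^{−K}`; NOT
ℝ⁴, NOT OS, NOT a mass gap, NOT Clay.  No `sorry`, `axiom`, `instance`, `notation`.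
Sources (SHAPE only): [III] Thm 1 p.262, Theorem p.245, (2.17)–(2.18) p.257, (2.23)–(2.25) pp.258–259, (2.30) p.260, (2.40) p.261, (3.1) p.264, (3.24)–(3.25) p.270,
(3.23) p.270; [IV] (0.2)–(0.4) p.176, p.177 (i)–(ii).
-/

noncomputable section

open MeasureTheory
open scoped BigOperators ENNReal NNReal Matrix.Norms.L2Operator

namespace Summit.QuantumFields.YangMills.Theorems.BalabanUVNodesN11Sect3SupplyChainZero

open Literature.MathematicalPhysics.QuantumFieldTheory.Balaban1983to89 T4Continuum Node00 Node00.Tk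
open B10Eq42TorusConstraint (bondsIn)
open B15DeterminingSets (MSField)
open Literature.MathematicalPhysics.QuantumFieldTheory.Balaban1983to89.B16RLeafRecord13AtLive (E0_nonneg_theta13LiveOfFamily)
open BalabanUVNodesN11HistoryPinnedResidualDefs (ZhPinOfRecord₁₃)
open BalabanUVNodesN11FluctTruncationDefs (IsFluctLocal)
open BalabanUVNodesN11Sect3SupplySpliceDefs
open BalabanUVNodesN11Sect3SupplySpliceOwnBoundary (graftAboveB graftAboveB_E_of_le graftAboveB_R_of_le graftAboveB_B_of_lt graftAboveB_B_of_le graftAboveB_E_of_lt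
  graftAboveB_R_of_lt)
open BalabanUVNodesN11Sect3SupplyChainDefs
open BalabanUVNodesN11Sect3SupplyChainObligationsDefs
open BalabanUVNodesN11Sect3SupplyChainNode (sLaw₁₃CoPH_all_of_obligations_of_rows sLaw₁₃CoPH_all_of_obligations_of_gaussCert
  sLaw₁₃CoPH_all_gaussCertH_theta13LiveOfRecord_of_obligations_of_operandRows)
open BalabanUVNodesN11FirstStepSupply (sect2Operand_congr_of_agree_pos)
open BalabanUVNodesN11OperandRowsOfTermRows (measurable_sect2Operand_of_termRows exists_bound_sect2Operand_of_termBounds)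
open BalabanUVNodesN11BackgroundCoPMeasurable (measurable_UbgOfRecord₁₃CoP)

variable {F : T4Family} {N : ℕ} [NeZero N]
variable (θ : Stage13HParams F N) (p : B12.RunParams)

/-! ## §1  The zero supplier and its chain -/

section Zero

/-- **THE ZERO SUPPLIER**: at every level, whatever the witness, NO new terms (`Sect2.TermValues.zero` at every history of length `k+1`) and the constant carried along
(`E_{k+1}(s′) := E_k(init s′)`).  The supplier of the degenerate world in which [III] §3 has nothing to construct. [cite: Balaban1988Convergent, Thm 1 p.262, §3 p.279 (bookkeeping)] -/
def zeroSupplier (θ : Stage13HParams F N) (p : B12.RunParams) : Sect3Supplier θ p :=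
  fun _ _ Ek => (fun _ => Sect2.TermValues.zero, fun s => Ek s.init)

variable {θ p}

/-- The zero supplier's response, unfolded (`rfl`). [cite: Balaban1988Convergent, §3 p.279 (bookkeeping)] -/
theorem zeroSupplier_fst (k : ℕ) (t : SeqOfRecord F θ.ν θ.τ9.M (gOfRecord₁₃ F N θ.toStage13Params p) p.K k → Sect2.TermValues (F.P p.K) (MatA N) (FluctV N) θ.τ9.M)
    (Ek : SeqOfRecord F θ.ν θ.τ9.M (gOfRecord₁₃ F N θ.toStage13Params p) p.K k → ℝ) (s : SeqOfRecord F θ.ν θ.τ9.M (gOfRecord₁₃ F N θ.toStage13Params p) p.K (k + 1)) :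
    (zeroSupplier θ p k t Ek).1 s = Sect2.TermValues.zero := rfl

/-- Zero term values are `k`-local for every `k` (they read nothing). [cite: Balaban1988Convergent, (2.40)–(2.41) p.261 (bookkeeping)] -/
theorem isFluctLocal_zero (k : ℕ) : IsFluctLocal k (Sect2.TermValues.zero : Sect2.TermValues (F.P p.K) (MatA N) (FluctV N) θ.τ9.M) :=
  ⟨fun _ _ _ _ _ _ _ => rfl⟩

/-- **ONE SPLICE WITH A ZERO RESPONSE**: if the old witness value `t (init s′)` vanishes at the level `j` whenever `j ≤ k`, then the splice with the zero response vanishes at level `j`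
(any `j`) — in each of the three cases of the splice (no-expansion ∕ 𝐓-absent ∕ 𝐓-present; `dropBFrom` only zeroes more, the levels above `k` come from the zero response).
[cite: Balaban1988Convergent, (3.25) p.270, §3 p.279 (bookkeeping)] -/
theorem spliceTermsB_zero_agree_pos (k : ℕ) (t : SeqOfRecord F θ.ν θ.τ9.M (gOfRecord₁₃ F N θ.toStage13Params p) p.K k → Sect2.TermValues (F.P p.K) (MatA N) (FluctV N) θ.τ9.M)
    (s : SeqOfRecord F θ.ν θ.τ9.M (gOfRecord₁₃ F N θ.toStage13Params p) p.K (k + 1)) (j : ℕ)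
    (ht : j ≤ k →
      (∀ (X : (Sect2.domSys (F.P p.K) θ.τ9.M j).Dom) (z : Site (F.P p.K) j) (gc : ℝ) (φ : Sect2.CPair (F.P p.K) (MatA N)), (t s.init).E j X z gc φ = 0) ∧
      (∀ (X : (Sect2.domSys (F.P p.K) θ.τ9.M j).Dom) (φ : Sect2.CPair (F.P p.K) (MatA N)), (t s.init).R j X φ = 0) ∧
      (∀ (X : (Sect2.domSys (F.P p.K) θ.τ9.M j).Dom) (φ : Sect2.CPair (F.P p.K) (MatA N)) (a : SFluct (F.P p.K) (FluctV N)), (t s.init).B j X φ a = 0)) :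
    (∀ (X : (Sect2.domSys (F.P p.K) θ.τ9.M j).Dom) (z : Site (F.P p.K) j) (gc : ℝ) (φ : Sect2.CPair (F.P p.K) (MatA N)),
        (spliceTermsB θ p k t (fun _ => Sect2.TermValues.zero) s).E j X z gc φ = 0) ∧
    (∀ (X : (Sect2.domSys (F.P p.K) θ.τ9.M j).Dom) (φ : Sect2.CPair (F.P p.K) (MatA N)), (spliceTermsB θ p k t (fun _ => Sect2.TermValues.zero) s).R j X φ = 0) ∧
    (∀ (X : (Sect2.domSys (F.P p.K) θ.τ9.M j).Dom) (φ : Sect2.CPair (F.P p.K) (MatA N)) (a : SFluct (F.P p.K) (FluctV N)),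
        (spliceTermsB θ p k t (fun _ => Sect2.TermValues.zero) s).B j X φ a = 0) := by
  by_cases hjk : j ≤ k
  · obtain ⟨hE, hR, hB⟩ := ht hjk
    by_cases hΩ : s.Ω (k + 1) = ∅
    · rw [spliceTermsB_of_Omega_empty _ _ s hΩ]
      exact ⟨fun X z gc φ => by rw [graftAbove_E_of_le _ _ hjk]; exact hE X z gc φ,
        fun X φ => by rw [graftAbove_R_of_le _ _ hjk]; exact hR X φ,
        fun X φ a => by rw [graftAbove_B_of_le _ _ hjk]; exact hB X φ a⟩
    by_cases h0 : slotsTOfRecord F N θ.ν θ.τ9 (EOfRecord₁₃ F N θ.toStage13Params) (wOfRecord₉ F N θ.toStage9Params) θ.ppSel p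
        (gOfRecord₁₃ F N θ.toStage13Params p) (k + 1) s = 0
    · rw [spliceTermsB_of_absent _ _ s hΩ h0]
      refine ⟨fun X z gc φ => by rw [graftAbove_E_of_le _ _ hjk]; exact hE X z gc φ,
        fun X φ => by rw [graftAbove_R_of_le _ _ hjk]; exact hR X φ, fun X φ a => ?_⟩
      rw [graftAbove_B_of_le _ _ hjk]
      by_cases hjk' : j < k
      · rw [dropBFrom_B_of_lt _ hjk']; exact hB X φ a
      · exact dropBFrom_B_of_le _ (not_lt.mp hjk') X φ a
    · rw [spliceTermsB_of_present _ _ s hΩ h0]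
      refine ⟨fun X z gc φ => by rw [graftAboveB_E_of_le _ _ hjk]; exact hE X z gc φ,
        fun X φ => by rw [graftAboveB_R_of_le _ _ hjk]; exact hR X φ, fun X φ a => ?_⟩
      by_cases hjk' : j < k
      · rw [graftAboveB_B_of_lt _ _ hjk']; exact hB X φ a
      · rw [graftAboveB_B_of_le _ _ (not_lt.mp hjk')]; rfl
  · have hjk' : k < j := not_le.mp hjk
    by_cases hΩ : s.Ω (k + 1) = ∅
    · rw [spliceTermsB_of_Omega_empty _ _ s hΩ]
      exact ⟨fun X z gc φ => by rw [graftAbove_E_of_lt _ _ hjk']; rfl, fun X φ => by rw [graftAbove_R_of_lt _ _ hjk']; rfl,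
        fun X φ a => by rw [graftAbove_B_of_lt _ _ hjk']; rfl⟩
    by_cases h0 : slotsTOfRecord F N θ.ν θ.τ9 (EOfRecord₁₃ F N θ.toStage13Params) (wOfRecord₉ F N θ.toStage9Params) θ.ppSel p
        (gOfRecord₁₃ F N θ.toStage13Params p) (k + 1) s = 0
    · rw [spliceTermsB_of_absent _ _ s hΩ h0]
      exact ⟨fun X z gc φ => by rw [graftAbove_E_of_lt _ _ hjk']; rfl, fun X φ => by rw [graftAbove_R_of_lt _ _ hjk']; rfl,
        fun X φ a => by rw [graftAbove_B_of_lt _ _ hjk']; rfl⟩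
    · rw [spliceTermsB_of_present _ _ s hΩ h0]
      exact ⟨fun X z gc φ => by rw [graftAboveB_E_of_lt _ _ hjk']; rfl, fun X φ => by rw [graftAboveB_R_of_lt _ _ hjk']; rfl,
        fun X φ a => by rw [graftAboveB_B_of_le _ _ hjk'.le]; rfl⟩

/-- **★ ALONG THE ZERO SUPPLIER's CHAIN EVERY TERM VALUE AT THE LEVELS `1 ≤ j ≤ k` IS ZERO** (induction over the splice, one splice at a time by the lemma above; the opaque
level-`0` terms of def-T's base witness are never touched by the claim — (2.25)∕(2.30)∕(2.40) sum over `j ≥ 1`). [cite: Balaban1988Convergent, (2.25) p.259, (2.30) p.260, (2.40) p.261, §3 p.279 (bookkeeping)] -/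
theorem chainWitness_zeroSupplier_agree_pos :
    ∀ (k : ℕ) (s : SeqOfRecord F θ.ν θ.τ9.M (gOfRecord₁₃ F N θ.toStage13Params p) p.K k) (j : ℕ), 1 ≤ j → j ≤ k →
      (∀ (X : (Sect2.domSys (F.P p.K) θ.τ9.M j).Dom) (z : Site (F.P p.K) j) (gc : ℝ) (φ : Sect2.CPair (F.P p.K) (MatA N)),
          ((chainWitness θ p (zeroSupplier θ p) k).1 s).E j X z gc φ = 0) ∧
      (∀ (X : (Sect2.domSys (F.P p.K) θ.τ9.M j).Dom) (φ : Sect2.CPair (F.P p.K) (MatA N)), ((chainWitness θ p (zeroSupplier θ p) k).1 s).R j X φ = 0) ∧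
      (∀ (X : (Sect2.domSys (F.P p.K) θ.τ9.M j).Dom) (φ : Sect2.CPair (F.P p.K) (MatA N)) (a : SFluct (F.P p.K) (FluctV N)),
          ((chainWitness θ p (zeroSupplier θ p) k).1 s).B j X φ a = 0) := by
  intro k
  induction k with
  | zero => intro s j h1 h0; omega
  | succ k ih =>
    intro s j h1 _
    exact spliceTermsB_zero_agree_pos (θ := θ) (p := p) k (chainWitness θ p (zeroSupplier θ p) k).1 s j fun hjk => ih s.init j h1 hjk

/-- **THE OPERAND OF THE ZERO CHAIN IS THE TERM-FREE OPERAND** `exp A_k[no terms]` (dag-n08-w2's `sect2Operand_congr_of_agree_pos`: (2.23) reads the levels `1 … k` only).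
[cite: Balaban1988Convergent, (2.18) p.257, (2.23)–(2.25) pp.258–259, (2.30) p.260, (2.40) p.261] -/
theorem sect2Operand_chainWitness_zeroSupplier (k : ℕ) (s : SeqOfRecord F θ.ν θ.τ9.M (gOfRecord₁₃ F N θ.toStage13Params p) p.K k)
    (S : Sect2.Setting (MatA N) (SU N)) (Rz : Sect2.Residual (F.P p.K) (MatA N)) (E₀ : ℝ) (U : BgMap F N p.K) :
    sect2Operand F N (FluctV N) p.K S Rz s ((chainWitness θ p (zeroSupplier θ p) k).1 s) E₀ U =
      sect2Operand F N (FluctV N) p.K S Rz s Sect2.TermValues.zero E₀ U :=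
  sect2Operand_congr_of_agree_pos S Rz s
    (fun j h1 hj X z gc φ => (chainWitness_zeroSupplier_agree_pos (θ := θ) (p := p) k s j h1 hj).1 X z gc φ)
    (fun j h1 hj X φ => (chainWitness_zeroSupplier_agree_pos (θ := θ) (p := p) k s j h1 hj).2.1 X φ)
    (fun j h1 hj X φ a => (chainWitness_zeroSupplier_agree_pos (θ := θ) (p := p) k s j h1 hj).2.2 X φ a) E₀ U

end Zero

/-! ## §2  def-T's operand rows hold outright along the zero chain; the obligations are met by the zero supplier where no expansion child carries a 𝐓-slot -/

section Rows

variable {θ p}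

/-- **def-T's TWO OPERAND ROWS FOR THE TERM-FREE OPERAND AT ANY HISTORY**: measurable on the multiscale configuration space (dag-n11-d's `measurable_sect2Operand_of_termRows`
at zero term rows + def-R's measurable background `measurable_UbgOfRecord₁₃CoP`) and bounded above (`exists_bound_sect2Operand_of_termBounds` at zero bounds).
[cite: Balaban1988Convergent, (2.20)–(2.23) p.258, (3.16)–(3.21) pp.268–269 (bookkeeping)] -/
theorem operandRowsAt_zero (k : ℕ) (s : SeqOfRecord F θ.ν θ.τ9.M (gOfRecord₁₃ F N θ.toStage13Params p) p.K (k + 1)) (E₀ : ℝ) :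
    OperandRowsAt θ p k s Sect2.TermValues.zero E₀ := fun S _ =>
  ⟨measurable_sect2Operand_of_termRows p.K _ _ s.init _ E₀ (measurable_UbgOfRecord₁₃CoP F N θ.toStage13Params p k s.init) S
      (fun _ _ _ _ => measurable_const) (fun _ _ => measurable_const) (fun _ _ => measurable_const),
    exists_bound_sect2Operand_of_termBounds p.K _ _ s.init _ E₀ _ ⟨0, fun _ _ _ _ _ => by simp [Sect2.TermValues.zero]⟩
      ⟨0, fun _ _ _ => by simp [Sect2.TermValues.zero]⟩ ⟨0, fun _ _ _ _ => by simp [Sect2.TermValues.zero]⟩⟩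

/-- **★★ def-T's OPERAND ROWS HOLD OUTRIGHT ALONG THE ZERO CHAIN** — `OperandRowsAlongChain θ p (zeroSupplier θ p)` with NO hypothesis (the chain's operand is the term-free one,
§1; its rows, above). [cite: Balaban1988Convergent, (2.20)–(2.23) p.258, (3.16)–(3.21) pp.268–269, (3.24) p.270] -/
theorem operandRowsAlongChain_zeroSupplier : OperandRowsAlongChain θ p (zeroSupplier θ p) := fun k _ _ s _ _ S hS => by
  obtain ⟨hm, hb⟩ := operandRowsAt_zero (θ := θ) (p := p) k s ((chainWitness θ p (zeroSupplier θ p) k).2 s.init) S hS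
  rw [sect2Operand_chainWitness_zeroSupplier k s.init]
  exact ⟨hm, hb⟩

/-- **THE FOUR 𝐄-CLAUSES HOLD FOR ZERO TERMS** at every history (`0 ≤ E₀`; analyticity of a constant). [cite: Balaban1988Convergent, (2.27)–(2.28) p.259 (bookkeeping)] -/
theorem newEClausesAt_zero (hE₀ : 0 ≤ θ.s2.lf.E₀) (k : ℕ) (s : SeqOfRecord F θ.ν θ.τ9.M (gOfRecord₁₃ F N θ.toStage13Params p) p.K (k + 1)) :
    NewEClausesAt θ p k Sect2.TermValues.zero s := by
  refine ⟨fun _ _ _ _ _ _ => rfl, fun _ _ _ _ _ => rfl, fun X z g φ _ _ _ => ?_, fun X z g _ _ => ?_⟩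
  · show ‖(0 : ℂ)‖ ≤ _
    rw [norm_zero]
    exact mul_nonneg hE₀ (Real.exp_nonneg _)
  · exact analyticOnNhd_const

/-- **★ THE OBLIGATIONS ARE CONSISTENT: IN A RUN WHOSE EXPANSION CHILDREN ARE ALL 𝐓-ABSENT THE ZERO SUPPLIER MEETS `SupplierObligations`** (`0 ≤ E₀` only) — (loc) zero terms
read nothing, (univE) a constant family, (newE) above, (present) vacuous by the absence hypothesis.  The degenerate world in which [III] §3 has nothing to construct.
[cite: Balaban1988Convergent, Thm 1 p.262, §3 p.279, (3.24)–(3.25) p.270 (bookkeeping)] -/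
theorem supplierObligations_zeroSupplier_of_forall_absent (hE₀ : 0 ≤ θ.s2.lf.E₀)
    (habs : ∀ k, k < p.K → ∀ s : SeqOfRecord F θ.ν θ.τ9.M (gOfRecord₁₃ F N θ.toStage13Params p) p.K (k + 1), s.Ω (k + 1) ≠ ∅ →
      slotsTOfRecord F N θ.ν θ.τ9 (EOfRecord₁₃ F N θ.toStage13Params) (wOfRecord₉ F N θ.toStage9Params) θ.ppSel p (gOfRecord₁₃ F N θ.toStage13Params p) (k + 1) s = 0) :
    SupplierObligations θ p (zeroSupplier θ p) where
  loc := fun k _ => isFluctLocal_zero (θ := θ) (p := p) (k + 1)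
  univE := fun _ _ _ => Sect2.universalE_const _
  newE := fun k _ _ s => newEClausesAt_zero hE₀ k s
  present := fun k hk _ s hΩ hT => absurd (habs k hk s hΩ) hT

/-- **`SupplyChainAt θ p` IN SUCH A RUN from the no-expansion obligation of the zero chain alone.** [cite: Balaban1988Convergent, Thm 1 p.262 (bookkeeping)] -/
theorem supplyChainAt_of_forall_absent (hE₀ : 0 ≤ θ.s2.lf.E₀)
    (habs : ∀ k, k < p.K → ∀ s : SeqOfRecord F θ.ν θ.τ9.M (gOfRecord₁₃ F N θ.toStage13Params p) p.K (k + 1), s.Ω (k + 1) ≠ ∅ →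
      slotsTOfRecord F N θ.ν θ.τ9 (EOfRecord₁₃ F N θ.toStage13Params) (wOfRecord₉ F N θ.toStage9Params) θ.ppSel p (gOfRecord₁₃ F N θ.toStage13Params p) (k + 1) s = 0)
    (hT : NoExpansionObligation θ p (zeroSupplier θ p)) : SupplyChainAt θ p :=
  ⟨zeroSupplier θ p, supplierObligations_zeroSupplier_of_forall_absent hE₀ habs, hT⟩

end Rows

/-! ## §3  Theorem 1 of [III] in a run without 𝐓-present expansion children -/

section TheoremOne

variable {θ p}

/-- **★★ THEOREM 1 OF [III] AT A GENERIC `θ`, ALL LEVELS, ALL HISTORIES, IN A RUN WHOSE EXPANSION CHILDREN ARE ALL 𝐓-ABSENT — FROM THE WITNESS-FREE RESIDUAL ROWS ALONE**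
(`ResidualRows θ p`: the four pins of the general step, measurability of the residual, K0b's A-fibre domination; live-selector line; core provisos, `ZhUnity`): the zero supplier
meets its obligations (§2), its operand rows hold outright (§2), so `…SupplyChainNode.sLaw₁₃CoPH_all_of_obligations_of_rows` closes.  NO operand row, NO supply.
[cite: Balaban1988Convergent, Thm 1 p.262, Theorem p.245, (3.24)–(3.25) p.270, (3.16)–(3.21) pp.268–269; Balaban1989LargeFieldI, (0.2)–(0.4) p.176, p.177 (i)–(ii)] -/
theorem sLaw₁₃CoPH_all_of_forall_absent_of_residualRows (h : θ.Provisos₁₃CoPH F N) (hU : θ.ZhUnity F N)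
    (hsel : θ.ppSel = ppSelLiveOfRecord F N θ.ν θ.τ9 (EOfRecord₁₃ F N θ.toStage13Params) (wOfRecord₉ F N θ.toStage9Params))
    (hθ : θ.Admissible F N) (hκ : 0 ≤ θ.s2.lf.κ) (hE₀ : 0 ≤ θ.s2.lf.E₀) (hB₀ : 0 ≤ θ.s2.lf.B₀) (hM : 1 ≤ θ.τ9.M)
    (habs : ∀ k, k < p.K → ∀ s : SeqOfRecord F θ.ν θ.τ9.M (gOfRecord₁₃ F N θ.toStage13Params p) p.K (k + 1), s.Ω (k + 1) ≠ ∅ →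
      slotsTOfRecord F N θ.ν θ.τ9 (EOfRecord₁₃ F N θ.toStage13Params) (wOfRecord₉ F N θ.toStage9Params) θ.ppSel p (gOfRecord₁₃ F N θ.toStage13Params p) (k + 1) s = 0)
    (hres : ResidualRows θ p) : ∀ k, k ≤ p.K → SLaw₁₃CoPH F N θ p k :=
  sLaw₁₃CoPH_all_of_obligations_of_rows h hU hsel hθ hκ hE₀ hB₀ hM (zeroSupplier θ p) (supplierObligations_zeroSupplier_of_forall_absent hE₀ habs) hres
    operandRowsAlongChain_zeroSupplier

/-- **★★ THEOREM 1 OF [III] AT ANY `θ` OF THE GAUSSIAN-CERTIFICATE CLASS, ALL LEVELS, IN A RUN WHOSE EXPANSION CHILDREN ARE ALL 𝐓-ABSENT — FROM NOTHING OF THE NO-EXPANSION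
LANE** (certificate `ζ0`, A-fibre Gaussian `quad`; live-selector line; core provisos): dag-n11-w1's witness-keyed face discharges the residual rows, §2 the operand rows and the
obligations. [cite: Balaban1988Convergent, Thm 1 p.262, Theorem p.245, (3.23)–(3.25) p.270; Balaban1989LargeFieldI, (0.2)–(0.4) p.176, p.177 (i)–(ii)] -/
theorem sLaw₁₃CoPH_all_of_forall_absent_of_gaussCert
    (hζ : ∀ (p : B12.RunParams) (n : ℕ) (Ω Λ : ℕ → Set (Site (F.P p.K) 0)), (θ.Zh p n Ω Λ).ζ0 = (ZhPinOfRecord₁₃ θ.toStage13Params p Ω Λ).ζ0)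
    (hq : ∀ (p : B12.RunParams) (n : ℕ) (Ω Λ : ℕ → Set (Site (F.P p.K) 0)) (j : ℕ) (Λ' : Set (Site (F.P p.K) 0)) (ω : MultiCfg (F.P p.K) (SU N) (FluctV N)),
      (θ.Zh p n Ω Λ).quad j Λ' ω = ∑ b ∈ (Set.toFinite (bondsIn j (Λ'ᶜ ∩ Ω (j + 1)))).toFinset, ‖(ω j).2 b‖ ^ 2)
    (h : θ.Provisos₁₃CoPH F N)
    (hsel : θ.ppSel = ppSelLiveOfRecord F N θ.ν θ.τ9 (EOfRecord₁₃ F N θ.toStage13Params) (wOfRecord₉ F N θ.toStage9Params))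
    (hθ : θ.Admissible F N) (hκ : 0 ≤ θ.s2.lf.κ) (hE₀ : 0 ≤ θ.s2.lf.E₀) (hB₀ : 0 ≤ θ.s2.lf.B₀) (hM : 1 ≤ θ.τ9.M)
    (habs : ∀ k, k < p.K → ∀ s : SeqOfRecord F θ.ν θ.τ9.M (gOfRecord₁₃ F N θ.toStage13Params p) p.K (k + 1), s.Ω (k + 1) ≠ ∅ →
      slotsTOfRecord F N θ.ν θ.τ9 (EOfRecord₁₃ F N θ.toStage13Params) (wOfRecord₉ F N θ.toStage9Params) θ.ppSel p (gOfRecord₁₃ F N θ.toStage13Params p) (k + 1) s = 0) :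
    ∀ k, k ≤ p.K → SLaw₁₃CoPH F N θ p k :=
  sLaw₁₃CoPH_all_of_obligations_of_gaussCert hζ hq h hsel hθ hκ hE₀ hB₀ hM (zeroSupplier θ p) (supplierObligations_zeroSupplier_of_forall_absent hE₀ habs)
    operandRowsAlongChain_zeroSupplier

variable (F N)
variable {Zr : (q : B12.RunParams) → TkResidualW F N (FluctV N) q.K}
  {Zh : (q : B12.RunParams) → ℕ → (ℕ → Set (Site (F.P q.K) 0)) → (ℕ → Set (Site (F.P q.K) 0)) → TkResidualW F N (FluctV N) q.K}
  {Phih : (q : B12.RunParams) → ℕ → (ℕ → Set (Site (F.P q.K) 0)) → (ℕ → Set (Site (F.P q.K) 0)) → (ℕ → Plaq (F.P q.K) 0 → ℝ)} (p : B12.RunParams)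

/-- **★★★ THEOREM 1 OF [III] AT ANY GAUSSIAN-CLASS H-EXTENSION OF THE WITNESS OF RECORD, ALL LEVELS, ALL HISTORIES, IN A RUN WHOSE EXPANSION CHILDREN ARE ALL 𝐓-ABSENT —
FROM `hrec` (the datum's key) AND THE ABSENCE HYPOTHESIS, NOTHING ELSE**: selector `rfl`, admissibility, the signs and `M = 1` are the family's (Node §3), the residual rows are
the certificate's, the operand rows and the obligations are the zero chain's (§2).  dag-n11-e g13 proved this along the ONE all-large history; here it holds at EVERY history of
such a run. [cite: Balaban1988Convergent, Thm 1 p.262, Theorem p.245, p.244, (3.23)–(3.25) p.270, (1.11) p.248, (3.16)–(3.22) pp.268–269; Balaban1989LargeFieldI, (0.3)–(0.4) p.176, p.177 (i)–(ii)] -/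
theorem sLaw₁₃CoPH_all_gaussCertH_theta13LiveOfRecord_of_forall_absent
    (hζ : ∀ (p : B12.RunParams) (n : ℕ) (Ω Λ : ℕ → Set (Site (F.P p.K) 0)), (Zh p n Ω Λ).ζ0 = (ZhPinOfRecord₁₃ (theta13LiveOfRecord F N) p Ω Λ).ζ0)
    (hq : ∀ (p : B12.RunParams) (n : ℕ) (Ω Λ : ℕ → Set (Site (F.P p.K) 0)) (j : ℕ) (Λ' : Set (Site (F.P p.K) 0)) (ω : MultiCfg (F.P p.K) (SU N) (FluctV N)),
      (Zh p n Ω Λ).quad j Λ' ω = ∑ b ∈ (Set.toFinite (bondsIn j (Λ'ᶜ ∩ Ω (j + 1)))).toFinset, ‖(ω j).2 b‖ ^ 2)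
    (hrec : (⟨⟨theta13LiveOfRecord F N, Zr⟩, Zh, Phih⟩ : Stage13HParams F N).Provisos₁₃CoPH F N)
    (habs : ∀ k, k < p.K → ∀ s : SeqOfRecord F (theta13LiveOfRecord F N).ν (theta13LiveOfRecord F N).τ9.M (gOfRecord₁₃ F N (theta13LiveOfRecord F N) p) p.K (k + 1),
      s.Ω (k + 1) ≠ ∅ → slotsTOfRecord F N (theta13LiveOfRecord F N).ν (theta13LiveOfRecord F N).τ9 (EOfRecord₁₃ F N (theta13LiveOfRecord F N))
        (wOfRecord₉ F N (theta13LiveOfRecord F N).toStage9Params) (theta13LiveOfRecord F N).ppSel p (gOfRecord₁₃ F N (theta13LiveOfRecord F N) p) (k + 1) s = 0) :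
    ∀ k, k ≤ p.K → SLaw₁₃CoPH F N (⟨⟨theta13LiveOfRecord F N, Zr⟩, Zh, Phih⟩ : Stage13HParams F N) p k :=
  sLaw₁₃CoPH_all_gaussCertH_theta13LiveOfRecord_of_obligations_of_operandRows F N p hζ hq hrec (zeroSupplier _ p)
    (supplierObligations_zeroSupplier_of_forall_absent
      (E0_nonneg_theta13LiveOfFamily F N eps0OfRecord₁₃ (zeta316OfRecord F N (numerics7OfFamily eps0OfRecord₁₃) 1 1) (RzOfRecord F N) (ZtOfRecord F N)) habs)
    operandRowsAlongChain_zeroSupplier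

end TheoremOne

end Summit.QuantumFields.YangMills.Theorems.BalabanUVNodesN11Sect3SupplyChainZero

end
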